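import Summits.QuantumFields.BalabanUV.T4Continuum.Support.VariationalVectorCentredCurl
import Summits.QuantumFields.BalabanUV.T4Continuum.Support.VariationalVectorWeitzenbock
import Summits.QuantumFields.BalabanUV.T4Continuum.Support.VariationalInterpolantSharp
import Summits.QuantumFields.BalabanUV.T4Continuum.Support.VariationalColourRegularity

/-!
# T⁴ programme, spine node NE2 (U1a), lane P2 — DIV-INTERP FOR THE COMPONENTWISE CENTRED INTERPOLANT: the fine covariant divergence of `J_c W` against
# the interpolated coarse divergence (item «V-ONE-G WITH BACKGROUND», file 4b; model level; cell `pub-balaban`)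

NE2 formalisation swarm `b2b-balaban-t4-ne2-formalise-*`, leaf prover 01 GEN 8 (`prover-b2b-balaban-t4-ne2-formalise-leaf-01-g8-0`); journal INTENT
CLAIMS.log 2026-08-20 l.18200 ∕ l.19154.  The ONE displayed analytic input of file 3b (`VariationalVectorOneG.sqrt_oneG_le` ∕ `oneG_le_add`) is the raw quantity
`DIV = Σ_x‖div′(J W)(x) − L⁻¹•(interpv T′ Rc (div_{Rc} W))(x)‖²`; this file bounds it for the item's competitor `J_c W := (x,ν) ↦ interpv T′ Rc (W(·,ν)) x`.

MECHANISM.  For unitary `R′`, `div′V(x) = −Σ_μ R′(x−e_μ,μ)⋆(D′_μV_μ)(x−e_μ)` (`divV_eq_neg_sum`); file 4a's `norm_cDv_interpv_sub_le` gives `(D′_μ(interpv W_μ))(x′)`,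
`x′ = x − e_μ = bpt y′ j′`, as `T′(x′)⋆((1∕L)D_μW_μ(y′) + err₂(y′,j′,μ))` up to `m‖Φ_μ(x)‖`; the coarse divergence is `div_{Rc}W(y) = −Σ_μ Rc(y−e_μ,μ)⋆(D_μW_μ)(y−e_μ)`;
the frames are compared with the SAME two frame defects of V-COL-ONE (in-block `R′(x′,μ)T′(x)⋆ ≈ T′(x′)⋆`: the values differ by the second difference
`(D_μD_μW_μ)(y′ − e_μ)`; crossing `R′(x′,μ)T′(x)⋆ ≈ T′(x′)⋆Rc(y′,μ)`: the values agree EXACTLY), and the affine part `Σ_κ w(j_κ)•D_κ(div W)(y)` of the interpolated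
divergence is a second-order term:
 * §1 **`norm_divTerm_sub_le`** (pointwise, per direction `μ`, at `x′ = bpt y′ j′`, `x = x′ + e_μ`):
   `‖R′(x′,μ)⋆(D′_μ(interpv W_μ))(x′) − (1∕L)•T′(x)⋆Rc(blockOf x − e_μ,μ)⋆(D_μW_μ)(blockOf x − e_μ)‖
      ≤ (1∕L)‖(D_μD_μW_μ)(y′−e_μ)‖ + (1+m)‖err₂(W_μ)(y′,j′,μ)‖ + (m∕L)‖(D_μW_μ)(y′)‖ + m‖Φ_μ(x)‖`;
 * §2 **`divInterp_centred_le`** (lattice units): `DIV(J_c W) ≤ (d+1)·[ 4(L^{d−2}·hessV W + (1+m)²·(d∕4)L^{d−1}·hessV W + m²L^{d−2}·roughV W + 2(1+d²)m²·L^d·nsqV W)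
   + (d∕4)·L^{d−2}·Σ_{y,κ}‖(D_κ div_{Rc}W)(y)‖² ]` — every term a second difference, a frame defect, or the (raw, second-order) derivative of the coarse divergence.
In END units (`×c_f = ((nL)^d)⁻¹(nL)²`): `(L∕n²)`-multiples of `ρ_V`-type functionals and `(nLm)²`-multiples of `qWV`∕physical-rough — decaying under the class.

HONEST FRAMING (T4-DAG p. 1).  Lattice bookkeeping at MODEL level (frames ∕ bond operators DATA, c5); [folklore]; nothing printed is a hypothesis; no `def`,
no `def … : Prop`, no `sorry`; axioms standard.  With files 1–4b the `G′`-half of (ONE-min) for `J_c` is a kernel inequality modulo the scalar pair's displayed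
UB⁺∕P⁺∕REG⁺ and the raw second-order sizes; the composite-fibre defect bound of `J_c` remains OPEN; (ONE-min) ∕ V-END with background ∕ NE2 NOT proved;
NE3 OPEN; spine PROVED 0∕9 unchanged; rung (B)+1 on a fixed finite T⁴ — NOT infinite volume, NOT mass gap, NOT Clay.  HONEST DEPENDENCY (cell, verbatim):
continuum YM on T⁴ ⇐ BetaPertH ∧ nine spine estimates (0/9 proved); BetaPertH ⇐ (D1) ∧ (D4) ∧ CAP+tail; G-an2-4 gates asym, D1 and NE2/3/4.
-/

noncomputable section

namespace Summit.QuantumFields.BalabanUV.T4Continuum.VariationalVectorCentredDiv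

open Finset
open scoped InnerProductSpace
open Literature.MathematicalPhysics.QuantumFieldTheory.Balaban1983to89
open Literature.MathematicalPhysics.QuantumFieldTheory.Balaban1983to89.B5Prop11Plancherel (Tor fine unitVec)
open Literature.MathematicalPhysics.QuantumFieldTheory.Balaban1983to89.B5Block118 (bpt)
open Literature.MathematicalPhysics.QuantumFieldTheory.Balaban1983to89.B5Blocks16 (blockOf blockOf_bpt bpt_bijective)
open Literature.MathematicalPhysics.QuantumFieldTheory.Balaban1983to89.B5AverageCurlStokes (sum_blocks_real)
open Summit.QuantumFields.BalabanUV.T4Continuum.ScalarBlockTrialFunction (digits digits_bpt bpt_add_unitVec_of_lt bpt_add_unitVec_of_eq)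
open Summit.QuantumFields.BalabanUV.T4Continuum.VariationalColourFederbush (cDv dirUv norm_le_one_of_mem_unitary)
open Summit.QuantumFields.BalabanUV.T4Continuum.VariationalCovariantWeights (wt abs_wt_le)
open Summit.QuantumFields.BalabanUV.T4Continuum.VariationalColourBochner (DirAdjv)
open Summit.QuantumFields.BalabanUV.T4Continuum.VariationalColourInterpolant
  (Phiv PhiFv interpv hessv err2v PhiFv_bpt interpv_bpt norm_star_apply_le sum_norm_sq_PhiFv_le)
open Summit.QuantumFields.BalabanUV.T4Continuum.VariationalColourOneStep (sum_norm_err2v_sq_le)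
open Summit.QuantumFields.BalabanUV.T4Continuum.VectorBlockTrialForm (nsqV nsqV_nonneg roughV)
open Summit.QuantumFields.BalabanUV.T4Continuum.VariationalVectorWeitzenbock (divV divV_apply)
open Summit.QuantumFields.BalabanUV.T4Continuum.VariationalVectorOneStep (hessV)
open Summit.QuantumFields.BalabanUV.T4Continuum.VariationalVectorCentredCurl (norm_cDv_interpv_sub_le)
open Summit.QuantumFields.BalabanUV.T4Continuum.VariationalColourScalarPair (apply_star_apply)
open Summit.QuantumFields.BalabanUV.T4Continuum.VariationalColourRegularity (star_apply_apply)
open Summit.QuantumFields.BalabanUV.T4Continuum.VariationalInterpolantSharp (norm_sq_sum_wt_smul_le)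
open Summit.QuantumFields.BalabanUV.T4Continuum.VariationalCovariantFederbush (sq_sum_le_card_mul)

variable {d : ℕ} {E : Type*} [NormedAddCommGroup E] [InnerProductSpace ℂ E] [CompleteSpace E]

/-! ## §1 Pointwise, per direction -/

section Point

variable (L : ℕ) [NeZero L] (N : Fin d → ℕ) [∀ μ, NeZero (N μ)] (Rc : Tor N → Fin d → (E →L[ℂ] E)) (W : Tor N → Fin d → E)

/-- **DIV-INTERP, POINTWISE PER DIRECTION** (`x′ = bpt y′ j′`, `x = x′ + e_μ`; unitary `T′`, `R′`, `Rc`; the two frame defects `≤ m`):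
`‖R′(x′,μ)⋆(D′_μ(interpv W_μ))(x′) − (1∕L)•T′(x)⋆Rc(blockOf x − e_μ,μ)⋆(D_μW_μ)(blockOf x − e_μ)‖
   ≤ (1∕L)‖(D_μD_μW_μ)(y′−e_μ)‖ + (1+m)‖err₂(W_μ)(y′,j′,μ)‖ + (m∕L)‖(D_μW_μ)(y′)‖ + m‖Φ_μ(x)‖`. [folklore] -/
theorem norm_divTerm_sub_le {T' : Tor (fine L N) → (E →L[ℂ] E)} (hT1 : ∀ x, T' x ∈ unitary (E →L[ℂ] E))
    {R' : Tor (fine L N) → Fin d → (E →L[ℂ] E)} (hR1 : ∀ x μ, R' x μ ∈ unitary (E →L[ℂ] E)) (hRc1 : ∀ y μ, Rc y μ ∈ unitary (E →L[ℂ] E)) {m : ℝ} (hm : 0 ≤ m)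
    (hin : ∀ (y : Tor N) (j : Fin d → Fin L) (μ : Fin d), (j μ : ℕ) + 1 < L →
      ‖R' (bpt L N y j) μ * star (T' (bpt L N y j + unitVec (fine L N) μ)) - star (T' (bpt L N y j))‖ ≤ m)
    (hcross : ∀ (y : Tor N) (j : Fin d → Fin L) (μ : Fin d), (j μ : ℕ) + 1 = L →
      ‖R' (bpt L N y j) μ * star (T' (bpt L N y j + unitVec (fine L N) μ)) - star (T' (bpt L N y j)) * Rc y μ‖ ≤ m)
    (y' : Tor N) (j' : Fin d → Fin L) (μ : Fin d) :
    ‖star (R' (bpt L N y' j') μ) (cDv (fine L N) R' (interpv L N T' Rc (fun z => W z μ)) (bpt L N y' j') μ)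
        - ((L : ℂ))⁻¹ • star (T' (bpt L N y' j' + unitVec (fine L N) μ))
            (star (Rc (blockOf L N (bpt L N y' j' + unitVec (fine L N) μ) - unitVec N μ) μ)
              (cDv N Rc (fun z => W z μ) (blockOf L N (bpt L N y' j' + unitVec (fine L N) μ) - unitVec N μ) μ))‖
      ≤ ((L : ℝ))⁻¹ * ‖cDv N Rc (fun z => cDv N Rc (fun z => W z μ) z μ) (y' - unitVec N μ) μ‖
        + (1 + m) * ‖err2v L N Rc (fun z => W z μ) y' j' μ‖ + m * ((L : ℝ))⁻¹ * ‖cDv N Rc (fun z => W z μ) y' μ‖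
        + m * ‖PhiFv L N Rc (fun z => W z μ) (bpt L N y' j' + unitVec (fine L N) μ)‖ := by
  set x' := bpt L N y' j' with hx'
  set x := bpt L N y' j' + unitVec (fine L N) μ with hx
  set lam : Tor N → E := fun z => W z μ with hlam
  set D : E := cDv N Rc lam y' μ with hD
  set er : E := err2v L N Rc lam y' j' μ with her
  set A : E := cDv (fine L N) R' (interpv L N T' Rc lam) x' μ with hA
  set B : E := star (T' x') (((L : ℂ))⁻¹ • D + er) with hB
  have hL0 : (0 : ℝ) < L := by exact_mod_cast Nat.pos_of_ne_zero (NeZero.ne L)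
  have hnL : ‖((L : ℂ))⁻¹‖ = ((L : ℝ))⁻¹ := by rw [norm_inv, Complex.norm_natCast]
  -- file 4a: `‖A − B‖ ≤ m‖Φ(x)‖`
  have hAB : ‖A - B‖ ≤ m * ‖PhiFv L N Rc lam x‖ := norm_cDv_interpv_sub_le L N Rc lam hin hcross y' j' μ
  have hAB' : ‖star (R' x' μ) (A - B)‖ ≤ m * ‖PhiFv L N Rc lam x‖ := (norm_star_apply_le (hR1 x' μ) _).trans hAB
  have hD0 : 0 ≤ ((L : ℝ))⁻¹ * ‖cDv N Rc (fun z => cDv N Rc lam z μ) (y' - unitVec N μ) μ‖ := by positivity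
  have her0 : 0 ≤ (1 + m) * ‖er‖ := by positivity
  have hmD0 : 0 ≤ m * ((L : ℝ))⁻¹ * ‖D‖ := by positivity
  by_cases hlt : (j' μ : ℕ) + 1 < L
  · -- IN-BLOCK: `x = bpt y′ (j′+e_μ)`, `blockOf x = y′`, `err₂ = 0`; frames `R′(x′,μ)T′(x)⋆ ≈ T′(x′)⋆`
    have hne : ¬ ((j' μ : ℕ) + 1 = L) := by omega
    have hbx : blockOf L N x = y' := by rw [hx, bpt_add_unitVec_of_lt L N y' j' μ hlt, blockOf_bpt]
    have her0' : er = 0 := by rw [her, err2v, if_neg hne]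
    -- the frame relation: `R′⋆(T′(x′)⋆ v) = T′(x)⋆ v − R′⋆(G v)`, `G = R′T′(x)⋆ − T′(x′)⋆`
    have hG : ∀ v : E, star (R' x' μ) (star (T' x') v)
        = star (T' x) v - star (R' x' μ) ((R' x' μ * star (T' x) - star (T' x')) v) := by
      intro v
      rw [sub_apply, mul_apply_eq_comp, map_sub, star_apply_apply (hR1 x' μ)]
      abel
    have hGn : ∀ v : E, ‖star (R' x' μ) ((R' x' μ * star (T' x) - star (T' x')) v)‖ ≤ m * ‖v‖ := fun v =>
      (norm_star_apply_le (hR1 x' μ) _).trans ((ContinuousLinearMap.le_opNorm _ _).trans (mul_le_mul_of_nonneg_right (hin y' j' μ hlt) (norm_nonneg _)))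
    -- the second difference: `D − Rc(y′−e_μ)⋆ D₋ = Rc(y′−e_μ)⋆ (D_μD_μλ)(y′−e_μ)`
    have hDD : D - star (Rc (y' - unitVec N μ) μ) (cDv N Rc lam (y' - unitVec N μ) μ)
        = star (Rc (y' - unitVec N μ) μ) (cDv N Rc (fun z => cDv N Rc lam z μ) (y' - unitVec N μ) μ) := by
      have e : cDv N Rc (fun z => cDv N Rc lam z μ) (y' - unitVec N μ) μ
          = Rc (y' - unitVec N μ) μ D - cDv N Rc lam (y' - unitVec N μ) μ := by
        simp only [cDv, hD, sub_add_cancel]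
      rw [e, map_sub, star_apply_apply (hRc1 _ μ)]
    rw [hbx]
    calc ‖star (R' x' μ) A - ((L : ℂ))⁻¹ • star (T' x) (star (Rc (y' - unitVec N μ) μ) (cDv N Rc lam (y' - unitVec N μ) μ))‖
        = ‖star (R' x' μ) (A - B) + (((L : ℂ))⁻¹ • star (T' x) (star (Rc (y' - unitVec N μ) μ) (cDv N Rc (fun z => cDv N Rc lam z μ) (y' - unitVec N μ) μ))
            - star (R' x' μ) ((R' x' μ * star (T' x) - star (T' x')) (((L : ℂ))⁻¹ • D)))‖ := by
          congr 1
          rw [map_sub, hB, her0', add_zero, hG, ← hDD, map_sub, smul_sub, map_smul]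
          abel
      _ ≤ ‖star (R' x' μ) (A - B)‖ + (‖((L : ℂ))⁻¹ • star (T' x) (star (Rc (y' - unitVec N μ) μ) (cDv N Rc (fun z => cDv N Rc lam z μ) (y' - unitVec N μ) μ))‖
            + ‖star (R' x' μ) ((R' x' μ * star (T' x) - star (T' x')) (((L : ℂ))⁻¹ • D))‖) := (norm_add_le _ _).trans (add_le_add le_rfl (norm_sub_le _ _))
      _ ≤ m * ‖PhiFv L N Rc lam x‖ + (((L : ℝ))⁻¹ * ‖cDv N Rc (fun z => cDv N Rc lam z μ) (y' - unitVec N μ) μ‖ + m * (((L : ℝ))⁻¹ * ‖D‖)) := by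
          refine add_le_add hAB' (add_le_add ?_ ?_)
          · rw [norm_smul, hnL]
            exact mul_le_mul_of_nonneg_left ((norm_star_apply_le (hT1 x) _).trans (norm_star_apply_le (hRc1 _ μ) _)) (by positivity)
          · refine (hGn _).trans ?_
            rw [norm_smul, hnL]
      _ ≤ _ := by nlinarith [her0]
  · -- CROSSING: `x = bpt (y′+e_μ) j′[μ↦0]`, `blockOf x − e_μ = y′`; frames `R′(x′,μ)T′(x)⋆ ≈ T′(x′)⋆Rc(y′,μ)`: the leading values agree exactly
    have heq : (j' μ : ℕ) + 1 = L := by have := (j' μ).is_lt; omega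
    have hbx : blockOf L N x - unitVec N μ = y' := by rw [hx, bpt_add_unitVec_of_eq L N y' j' μ heq, blockOf_bpt, add_sub_cancel_right]
    have hG : ∀ v : E, star (R' x' μ) (star (T' x') v)
        = star (T' x) (star (Rc y' μ) v) - star (R' x' μ) ((R' x' μ * star (T' x) - star (T' x') * Rc y' μ) (star (Rc y' μ) v)) := by
      intro v
      rw [sub_apply, mul_apply_eq_comp, mul_apply_eq_comp, map_sub, star_apply_apply (hR1 x' μ), apply_star_apply (hRc1 y' μ)]
      abel
    have hGn : ∀ v : E, ‖star (R' x' μ) ((R' x' μ * star (T' x) - star (T' x') * Rc y' μ) (star (Rc y' μ) v))‖ ≤ m * ‖v‖ := fun v =>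
      (norm_star_apply_le (hR1 x' μ) _).trans ((ContinuousLinearMap.le_opNorm _ _).trans
        (mul_le_mul (hcross y' j' μ heq) (norm_star_apply_le (hRc1 y' μ) _) (norm_nonneg _) hm))
    rw [hbx]
    calc ‖star (R' x' μ) A - ((L : ℂ))⁻¹ • star (T' x) (star (Rc y' μ) D)‖
        = ‖star (R' x' μ) (A - B) + (star (T' x) (star (Rc y' μ) er)
            - star (R' x' μ) ((R' x' μ * star (T' x) - star (T' x') * Rc y' μ) (star (Rc y' μ) (((L : ℂ))⁻¹ • D + er))))‖ := by
          congr 1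
          rw [map_sub, hB, hG, map_add, map_add, map_smul, map_smul]
          abel
      _ ≤ ‖star (R' x' μ) (A - B)‖ + (‖star (T' x) (star (Rc y' μ) er)‖
            + ‖star (R' x' μ) ((R' x' μ * star (T' x) - star (T' x') * Rc y' μ) (star (Rc y' μ) (((L : ℂ))⁻¹ • D + er)))‖) :=
          (norm_add_le _ _).trans (add_le_add le_rfl (norm_sub_le _ _))
      _ ≤ m * ‖PhiFv L N Rc lam x‖ + (‖er‖ + m * (((L : ℝ))⁻¹ * ‖D‖ + ‖er‖)) := by
          refine add_le_add hAB' (add_le_add ((norm_star_apply_le (hT1 x) _).trans (norm_star_apply_le (hRc1 y' μ) _)) ?_)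
          refine (hGn _).trans (mul_le_mul_of_nonneg_left ((norm_add_le _ _).trans (add_le_add (le_of_eq ?_) le_rfl)) hm)
          rw [norm_smul, hnL]
      _ ≤ _ := by nlinarith [hD0]

end Point

/-! ## §2 Summed: DIV-INTERP for `J_c` in lattice units -/

section Sum

variable (L : ℕ) [NeZero L] (N : Fin d → ℕ) [∀ μ, NeZero (N μ)] (Rc : Tor N → Fin d → (E →L[ℂ] E)) (W : Tor N → Fin d → E)

omit [NeZero L] [∀ μ, NeZero (N μ)] in
/-- the adjoint difference through the forward one, unitary transports: `(D†_μ g)(x) = −R(x−e_μ,μ)⋆ (D_μ g)(x−e_μ)`. [folklore] -/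
theorem DirAdjv_eq_neg_star_cDv {R : Tor N → Fin d → (E →L[ℂ] E)} (hR : ∀ x μ, R x μ ∈ unitary (E →L[ℂ] E)) (μ : Fin d) (g : Tor N → E) (x : Tor N) :
    DirAdjv N R μ g x = -star (R (x - unitVec N μ) μ) (cDv N R g (x - unitVec N μ) μ) := by
  simp only [DirAdjv, cDv, map_sub, star_apply_apply (hR _ μ), sub_add_cancel]
  abel

omit [NeZero L] [CompleteSpace E] in
/-- a diagonal piece of the Hessian is below the Hessian: `Σ_μ Σ_y ‖(D_μD_μW_μ)(y)‖² ≤ hessV W`. [folklore] -/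
theorem sum_diag_hess_le :
    ∑ μ, ∑ y, ‖cDv N Rc (fun z => cDv N Rc (fun z => W z μ) z μ) y μ‖ ^ 2 ≤ hessV N Rc W := by
  unfold hessV hessv dirUv
  refine Finset.sum_le_sum fun μ _ => ?_
  calc ∑ y, ‖cDv N Rc (fun z => cDv N Rc (fun z => W z μ) z μ) y μ‖ ^ 2
      ≤ ∑ ν, ∑ y, ‖cDv N Rc (fun z => cDv N Rc (fun z => W z μ) z ν) y μ‖ ^ 2 :=
        Finset.single_le_sum (f := fun ν => ∑ y, ‖cDv N Rc (fun z => cDv N Rc (fun z => W z μ) z ν) y μ‖ ^ 2)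
          (fun _ _ => Finset.sum_nonneg fun _ _ => by positivity) (Finset.mem_univ μ)
    _ ≤ ∑ μ', ∑ ν, ∑ y, ‖cDv N Rc (fun z => cDv N Rc (fun z => W z μ) z ν) y μ'‖ ^ 2 :=
        Finset.single_le_sum (f := fun μ' => ∑ ν, ∑ y, ‖cDv N Rc (fun z => cDv N Rc (fun z => W z μ) z ν) y μ'‖ ^ 2)
          (fun _ _ => Finset.sum_nonneg fun _ _ => Finset.sum_nonneg fun _ _ => by positivity) (Finset.mem_univ μ)

omit [NeZero L] [CompleteSpace E] in
/-- a slice of the Hessian is below the Hessian: `Σ_μ Σ_κ Σ_y ‖(D_μD_κW_μ)(y)‖² ≤ hessV W`. [folklore] -/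
theorem sum_slice_hess_le :
    ∑ μ, ∑ κ, ∑ y, ‖cDv N Rc (fun z => cDv N Rc (fun z => W z μ) z κ) y μ‖ ^ 2 ≤ hessV N Rc W := by
  unfold hessV hessv dirUv
  refine Finset.sum_le_sum fun μ _ => ?_
  exact Finset.single_le_sum (f := fun μ' => ∑ ν, ∑ y, ‖cDv N Rc (fun z => cDv N Rc (fun z => W z μ) z ν) y μ'‖ ^ 2)
    (fun _ _ => Finset.sum_nonneg fun _ _ => Finset.sum_nonneg fun _ _ => by positivity) (Finset.mem_univ μ)

/-- **DIV-INTERP FOR THE COMPONENTWISE CENTRED INTERPOLANT (lattice units)**: unitary `T′`, `R′`, `Rc`; frame defects `≤ m`: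
`Σ_x‖div′(J_cW)(x) − L⁻¹•(interpv T′ Rc (div_{Rc}W))(x)‖² ≤ 8d·( L^d∕L²·hessV W + (1+m)²·(d∕4)L^{d−1}·hessV W + m²·L^d∕L²·Σ_{μ,y}‖(D_μW_μ)(y)‖²
  + m²·2(1+d²)·L^d·nsqV W ) + (d∕2)·L^d∕L²·Σ_{y,κ}‖(D_κ div_{Rc}W)(y)‖²`. [folklore] -/
theorem divInterp_centred_le {T' : Tor (fine L N) → (E →L[ℂ] E)} (hT1 : ∀ x, T' x ∈ unitary (E →L[ℂ] E))
    {R' : Tor (fine L N) → Fin d → (E →L[ℂ] E)} (hR1 : ∀ x μ, R' x μ ∈ unitary (E →L[ℂ] E)) (hRc1 : ∀ y μ, Rc y μ ∈ unitary (E →L[ℂ] E)) {m : ℝ} (hm : 0 ≤ m)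
    (hin : ∀ (y : Tor N) (j : Fin d → Fin L) (μ : Fin d), (j μ : ℕ) + 1 < L →
      ‖R' (bpt L N y j) μ * star (T' (bpt L N y j + unitVec (fine L N) μ)) - star (T' (bpt L N y j))‖ ≤ m)
    (hcross : ∀ (y : Tor N) (j : Fin d → Fin L) (μ : Fin d), (j μ : ℕ) + 1 = L →
      ‖R' (bpt L N y j) μ * star (T' (bpt L N y j + unitVec (fine L N) μ)) - star (T' (bpt L N y j)) * Rc y μ‖ ≤ m) :
    ∑ x, ‖divV (fine L N) R' (fun x' ν' => interpv L N T' Rc (fun z => W z ν') x') x - ((L : ℂ))⁻¹ • interpv L N T' Rc (divV N Rc W) x‖ ^ 2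
      ≤ 8 * d * ((L : ℝ) ^ d / (L : ℝ) ^ 2 * hessV N Rc W + (1 + m) ^ 2 * ((L : ℝ) ^ (d - 1) * ((d : ℝ) / 4 * hessV N Rc W))
          + m ^ 2 * ((L : ℝ) ^ d / (L : ℝ) ^ 2 * ∑ μ, ∑ y, ‖cDv N Rc (fun z => W z μ) y μ‖ ^ 2)
          + m ^ 2 * (2 * (1 + (d : ℝ) ^ 2) * ((L : ℝ) ^ d * nsqV N W)))
        + (d : ℝ) / 2 * ((L : ℝ) ^ d / (L : ℝ) ^ 2 * ∑ y, ∑ κ, ‖cDv N Rc (divV N Rc W) y κ‖ ^ 2) := by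
  have hL : (0 : ℝ) < L := by exact_mod_cast Nat.pos_of_ne_zero (NeZero.ne L)
  have hnL : ‖((L : ℂ))⁻¹‖ = ((L : ℝ))⁻¹ := by rw [norm_inv, Complex.norm_natCast]
  have hcardR : (Fintype.card (Fin d → Fin L) : ℝ) = (L : ℝ) ^ d := by
    rw [Fintype.card_fun, Fintype.card_fin, Fintype.card_fin]; push_cast; ring
  -- the per-direction bound as a function of the fine site (block coordinates of `x − e_μ`) and the affine part
  set U : Tor (fine L N) → Fin d → ℝ := fun x μ =>
    ((L : ℝ))⁻¹ * ‖cDv N Rc (fun z => cDv N Rc (fun z => W z μ) z μ) (blockOf L N (x - unitVec (fine L N) μ) - unitVec N μ) μ‖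
      + (1 + m) * ‖err2v L N Rc (fun z => W z μ) (blockOf L N (x - unitVec (fine L N) μ)) (digits L N (x - unitVec (fine L N) μ)) μ‖
      + m * ((L : ℝ))⁻¹ * ‖cDv N Rc (fun z => W z μ) (blockOf L N (x - unitVec (fine L N) μ)) μ‖
      + m * ‖PhiFv L N Rc (fun z => W z μ) x‖ with hU
  set V : Tor (fine L N) → ℝ := fun x => ((L : ℝ))⁻¹ * ‖∑ κ, ((wt L (digits L N x κ) : ℝ) : ℂ) • cDv N Rc (divV N Rc W) (blockOf L N x) κ‖ with hV
  -- pointwise: `‖D(x)‖ ≤ Σ_μ U x μ + V x`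
  have hpt : ∀ x, ‖divV (fine L N) R' (fun x' ν' => interpv L N T' Rc (fun z => W z ν') x') x - ((L : ℂ))⁻¹ • interpv L N T' Rc (divV N Rc W) x‖
      ≤ ∑ μ, U x μ + V x := by
    intro x
    obtain ⟨⟨y, j⟩, hx⟩ := (bpt_bijective L N).2 x
    dsimp only at hx
    have hby : blockOf L N x = y := by rw [← hx, blockOf_bpt]
    have hneg : ∀ (a b : E) (c : ℂ), -a - c • -b = -(a - c • b) := fun a b c => by rw [smul_neg]; abel
    -- per direction
    have hμ : ∀ μ, ‖-star (R' (x - unitVec (fine L N) μ) μ) (cDv (fine L N) R' (interpv L N T' Rc (fun z => W z μ)) (x - unitVec (fine L N) μ) μ)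
        - ((L : ℂ))⁻¹ • star (T' x) (-star (Rc (y - unitVec N μ) μ) (cDv N Rc (fun z => W z μ) (y - unitVec N μ) μ))‖ ≤ U x μ := by
      intro μ
      obtain ⟨⟨y', j'⟩, hx'⟩ := (bpt_bijective L N).2 (x - unitVec (fine L N) μ)
      dsimp only at hx'
      have hxe : x = bpt L N y' j' + unitVec (fine L N) μ := by rw [hx', sub_add_cancel]
      have h := norm_divTerm_sub_le L N Rc W hT1 hR1 hRc1 hm hin hcross y' j' μ
      rw [← hxe, hby] at h
      simp only [hU]
      rw [← hx', blockOf_bpt, digits_bpt, map_neg, hneg, norm_neg]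
      exact h
    -- the identity for `D(x)`
    have hdiv : divV (fine L N) R' (fun x' ν' => interpv L N T' Rc (fun z => W z ν') x') x
        = ∑ μ, -star (R' (x - unitVec (fine L N) μ) μ) (cDv (fine L N) R' (interpv L N T' Rc (fun z => W z μ)) (x - unitVec (fine L N) μ) μ) := by
      unfold divV
      exact Finset.sum_congr rfl fun μ _ => DirAdjv_eq_neg_star_cDv (fine L N) hR1 μ _ x
    have hint : interpv L N T' Rc (divV N Rc W) x
        = star (T' x) (∑ μ, -star (Rc (y - unitVec N μ) μ) (cDv N Rc (fun z => W z μ) (y - unitVec N μ) μ))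
          + star (T' x) (∑ κ, ((wt L (j κ) : ℝ) : ℂ) • cDv N Rc (divV N Rc W) y κ) := by
      rw [← hx, interpv_bpt, Phiv, map_add]
      congr 2
      unfold divV
      exact Finset.sum_congr rfl fun μ _ => DirAdjv_eq_neg_star_cDv N hRc1 μ _ y
    have hVx : V x = ((L : ℝ))⁻¹ * ‖∑ κ, ((wt L (j κ) : ℝ) : ℂ) • cDv N Rc (divV N Rc W) y κ‖ := by
      simp only [hV, ← hx, blockOf_bpt, digits_bpt]
    rw [hdiv, hint, smul_add, map_sum, smul_sum, ← sub_sub, ← Finset.sum_sub_distrib, hVx]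
    refine (norm_sub_le _ _).trans (add_le_add ((norm_sum_le _ _).trans (Finset.sum_le_sum fun μ _ => ?_)) ?_)
    · have := hμ μ
      rw [map_neg, smul_neg] at this ⊢
      exact this
    · rw [norm_smul, hnL]
      exact mul_le_mul_of_nonneg_left (norm_star_apply_le (hT1 x) _) (by positivity)
  -- squares: `‖D x‖² ≤ 2d·Σ_μ (U x μ)² + 2·(V x)²`
  have hU0 : ∀ x μ, 0 ≤ U x μ := fun x μ => by simp only [hU]; positivity
  have hV0 : ∀ x, 0 ≤ V x := fun x => by simp only [hV]; positivity
  have hsq : ∀ x, ‖divV (fine L N) R' (fun x' ν' => interpv L N T' Rc (fun z => W z ν') x') x - ((L : ℂ))⁻¹ • interpv L N T' Rc (divV N Rc W) x‖ ^ 2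
      ≤ 2 * d * ∑ μ, U x μ ^ 2 + 2 * V x ^ 2 := by
    intro x
    have h1 := pow_le_pow_left₀ (norm_nonneg _) (hpt x) 2
    have hcs := sq_sum_le_card_mul (Finset.univ : Finset (Fin d)) (fun μ => U x μ)
    rw [Finset.card_univ, Fintype.card_fin] at hcs
    have hS0 : 0 ≤ ∑ μ, U x μ := Finset.sum_nonneg fun μ _ => hU0 x μ
    nlinarith [h1, hcs, hV0 x, sq_nonneg (∑ μ, U x μ - V x)]
  -- the four pieces of `U²`
  have hU4 : ∀ x μ, U x μ ^ 2 ≤ 4 * ((((L : ℝ))⁻¹) ^ 2 * ‖cDv N Rc (fun z => cDv N Rc (fun z => W z μ) z μ) (blockOf L N (x - unitVec (fine L N) μ) - unitVec N μ) μ‖ ^ 2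
      + (1 + m) ^ 2 * ‖err2v L N Rc (fun z => W z μ) (blockOf L N (x - unitVec (fine L N) μ)) (digits L N (x - unitVec (fine L N) μ)) μ‖ ^ 2
      + m ^ 2 * ((((L : ℝ))⁻¹) ^ 2 * ‖cDv N Rc (fun z => W z μ) (blockOf L N (x - unitVec (fine L N) μ)) μ‖ ^ 2)
      + m ^ 2 * ‖PhiFv L N Rc (fun z => W z μ) x‖ ^ 2) := by
    intro x μ
    have h4 : ∀ a b c e : ℝ, (a + b + c + e) ^ 2 ≤ 4 * (a ^ 2 + b ^ 2 + c ^ 2 + e ^ 2) := fun a b c e => by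
      nlinarith [sq_nonneg (a - b), sq_nonneg (a - c), sq_nonneg (a - e), sq_nonneg (b - c), sq_nonneg (b - e), sq_nonneg (c - e)]
    have h := h4 (((L : ℝ))⁻¹ * ‖cDv N Rc (fun z => cDv N Rc (fun z => W z μ) z μ) (blockOf L N (x - unitVec (fine L N) μ) - unitVec N μ) μ‖)
      ((1 + m) * ‖err2v L N Rc (fun z => W z μ) (blockOf L N (x - unitVec (fine L N) μ)) (digits L N (x - unitVec (fine L N) μ)) μ‖)
      (m * ((L : ℝ))⁻¹ * ‖cDv N Rc (fun z => W z μ) (blockOf L N (x - unitVec (fine L N) μ)) μ‖) (m * ‖PhiFv L N Rc (fun z => W z μ) x‖)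
    simp only [hU]
    refine h.trans (le_of_eq ?_)
    ring
  -- translation `x ↦ x − e_μ` on the fine torus and `y ↦ y − e_μ` on the coarse torus
  have htrF : ∀ (μ : Fin d) (g : Tor (fine L N) → ℝ), ∑ x, g (x - unitVec (fine L N) μ) = ∑ x, g x := fun μ g =>
    Fintype.sum_equiv (Equiv.subRight (unitVec (fine L N) μ)) _ _ fun x => rfl
  have htrC : ∀ (μ : Fin d) (g : Tor N → ℝ), ∑ y, g (y - unitVec N μ) = ∑ y, g y := fun μ g =>
    Fintype.sum_equiv (Equiv.subRight (unitVec N μ)) _ _ fun y => rfl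
  -- T1: second differences
  have hT1 : ∑ x, ∑ μ, (((L : ℝ))⁻¹) ^ 2 * ‖cDv N Rc (fun z => cDv N Rc (fun z => W z μ) z μ) (blockOf L N (x - unitVec (fine L N) μ) - unitVec N μ) μ‖ ^ 2
      ≤ (L : ℝ) ^ d / (L : ℝ) ^ 2 * hessV N Rc W := by
    rw [Finset.sum_comm]
    have hμ : ∀ μ : Fin d, ∑ x, (((L : ℝ))⁻¹) ^ 2 * ‖cDv N Rc (fun z => cDv N Rc (fun z => W z μ) z μ) (blockOf L N (x - unitVec (fine L N) μ) - unitVec N μ) μ‖ ^ 2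
        = (L : ℝ) ^ d / (L : ℝ) ^ 2 * ∑ y, ‖cDv N Rc (fun z => cDv N Rc (fun z => W z μ) z μ) y μ‖ ^ 2 := by
      intro μ
      rw [htrF μ (fun x => (((L : ℝ))⁻¹) ^ 2 * ‖cDv N Rc (fun z => cDv N Rc (fun z => W z μ) z μ) (blockOf L N x - unitVec N μ) μ‖ ^ 2),
        sum_blocks_real L N]
      simp only [blockOf_bpt, Finset.sum_const, Finset.card_univ, nsmul_eq_mul, hcardR]
      rw [htrC μ (fun y => (L : ℝ) ^ d * ((((L : ℝ))⁻¹) ^ 2 * ‖cDv N Rc (fun z => cDv N Rc (fun z => W z μ) z μ) y μ‖ ^ 2)), Finset.mul_sum]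
      refine Finset.sum_congr rfl fun y _ => ?_
      rw [inv_pow, div_eq_mul_inv]; ring
    rw [Finset.sum_congr rfl fun μ _ => hμ μ, ← Finset.mul_sum]
    exact mul_le_mul_of_nonneg_left (sum_diag_hess_le N Rc W) (by positivity)
  -- T2: the `err₂` squares
  have hT2 : ∑ x, ∑ μ, (1 + m) ^ 2 * ‖err2v L N Rc (fun z => W z μ) (blockOf L N (x - unitVec (fine L N) μ)) (digits L N (x - unitVec (fine L N) μ)) μ‖ ^ 2
      ≤ (1 + m) ^ 2 * ((L : ℝ) ^ (d - 1) * ((d : ℝ) / 4 * hessV N Rc W)) := by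
    rw [Finset.sum_comm]
    have hμ : ∀ μ : Fin d, ∑ x, (1 + m) ^ 2 * ‖err2v L N Rc (fun z => W z μ) (blockOf L N (x - unitVec (fine L N) μ)) (digits L N (x - unitVec (fine L N) μ)) μ‖ ^ 2
        ≤ (1 + m) ^ 2 * ((L : ℝ) ^ (d - 1) * ((d : ℝ) / 4 * ∑ κ, ∑ y, ‖cDv N Rc (fun z => cDv N Rc (fun z => W z μ) z κ) y μ‖ ^ 2)) := by
      intro μ
      rw [htrF μ (fun x => (1 + m) ^ 2 * ‖err2v L N Rc (fun z => W z μ) (blockOf L N x) (digits L N x) μ‖ ^ 2), sum_blocks_real L N]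
      simp only [blockOf_bpt, digits_bpt, ← Finset.mul_sum]
      refine mul_le_mul_of_nonneg_left ?_ (sq_nonneg _)
      calc ∑ y : Tor N, ∑ j : Fin d → Fin L, ‖err2v L N Rc (fun z => W z μ) y j μ‖ ^ 2
          ≤ ∑ y : Tor N, (L : ℝ) ^ (d - 1) * ((d : ℝ) / 4 * ∑ κ, ‖cDv N Rc (fun z => cDv N Rc (fun z => W z μ) z κ) y μ‖ ^ 2) :=
            Finset.sum_le_sum fun y _ => sum_norm_err2v_sq_le L N Rc (fun z => W z μ) y μ
        _ = (L : ℝ) ^ (d - 1) * ((d : ℝ) / 4 * ∑ κ, ∑ y, ‖cDv N Rc (fun z => cDv N Rc (fun z => W z μ) z κ) y μ‖ ^ 2) := by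
            rw [← Finset.mul_sum, ← Finset.mul_sum, Finset.sum_comm]
    refine (Finset.sum_le_sum fun μ _ => hμ μ).trans ?_
    rw [← Finset.mul_sum, ← Finset.mul_sum, ← Finset.mul_sum]
    have h0 : 0 ≤ (1 + m) ^ 2 * ((L : ℝ) ^ (d - 1) * ((d : ℝ) / 4)) := by positivity
    have := mul_le_mul_of_nonneg_left (sum_slice_hess_le N Rc W) h0
    nlinarith [this]
  -- T3: first differences with `m²`
  have hT3 : ∑ x, ∑ μ, m ^ 2 * ((((L : ℝ))⁻¹) ^ 2 * ‖cDv N Rc (fun z => W z μ) (blockOf L N (x - unitVec (fine L N) μ)) μ‖ ^ 2)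
      = m ^ 2 * ((L : ℝ) ^ d / (L : ℝ) ^ 2 * ∑ μ, ∑ y, ‖cDv N Rc (fun z => W z μ) y μ‖ ^ 2) := by
    rw [Finset.sum_comm, Finset.mul_sum, Finset.mul_sum]
    refine Finset.sum_congr rfl fun μ _ => ?_
    rw [htrF μ (fun x => m ^ 2 * ((((L : ℝ))⁻¹) ^ 2 * ‖cDv N Rc (fun z => W z μ) (blockOf L N x) μ‖ ^ 2)), sum_blocks_real L N]
    simp only [blockOf_bpt, Finset.sum_const, Finset.card_univ, nsmul_eq_mul, hcardR]
    rw [Finset.mul_sum, Finset.mul_sum]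
    refine Finset.sum_congr rfl fun y _ => ?_
    rw [inv_pow, div_eq_mul_inv]; ring
  -- T4: the interpolant's size
  have hT4 : ∑ x, ∑ μ, m ^ 2 * ‖PhiFv L N Rc (fun z => W z μ) x‖ ^ 2 ≤ m ^ 2 * (2 * (1 + (d : ℝ) ^ 2) * ((L : ℝ) ^ d * nsqV N W)) := by
    rw [Finset.sum_comm]
    have hμ : ∀ μ : Fin d, ∑ x, m ^ 2 * ‖PhiFv L N Rc (fun z => W z μ) x‖ ^ 2 ≤ m ^ 2 * (2 * (1 + (d : ℝ) ^ 2) * ((L : ℝ) ^ d * ∑ y, ‖W y μ‖ ^ 2)) := by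
      intro μ
      rw [← Finset.mul_sum]
      exact mul_le_mul_of_nonneg_left (sum_norm_sq_PhiFv_le L N Rc (fun z => W z μ) fun y ν => norm_le_one_of_mem_unitary (hRc1 y ν)) (sq_nonneg m)
    refine (Finset.sum_le_sum fun μ _ => hμ μ).trans (le_of_eq ?_)
    unfold nsqV
    rw [← Finset.mul_sum, ← Finset.mul_sum, ← Finset.mul_sum, Finset.sum_comm]
  -- the affine part
  have hTV : ∑ x, V x ^ 2 ≤ (d : ℝ) / 4 * ((L : ℝ) ^ d / (L : ℝ) ^ 2 * ∑ y, ∑ κ, ‖cDv N Rc (divV N Rc W) y κ‖ ^ 2) := by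
    have hx : ∀ x, V x ^ 2 ≤ (((L : ℝ))⁻¹) ^ 2 * ((d : ℝ) / 4 * ∑ κ, ‖cDv N Rc (divV N Rc W) (blockOf L N x) κ‖ ^ 2) := by
      intro x
      simp only [hV, mul_pow]
      exact mul_le_mul_of_nonneg_left (norm_sq_sum_wt_smul_le L N Rc (divV N Rc W) (blockOf L N x) (digits L N x)) (sq_nonneg _)
    refine (Finset.sum_le_sum fun x _ => hx x).trans (le_of_eq ?_)
    rw [sum_blocks_real L N (fun x => (((L : ℝ))⁻¹) ^ 2 * ((d : ℝ) / 4 * ∑ κ, ‖cDv N Rc (divV N Rc W) (blockOf L N x) κ‖ ^ 2))]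
    simp only [blockOf_bpt, Finset.sum_const, Finset.card_univ, nsmul_eq_mul, hcardR]
    rw [Finset.mul_sum, Finset.mul_sum]
    refine Finset.sum_congr rfl fun y _ => ?_
    rw [inv_pow, div_eq_mul_inv]; ring
  -- collect
  have hUsum : ∑ x, ∑ μ, U x μ ^ 2 ≤ 4 * ((L : ℝ) ^ d / (L : ℝ) ^ 2 * hessV N Rc W + (1 + m) ^ 2 * ((L : ℝ) ^ (d - 1) * ((d : ℝ) / 4 * hessV N Rc W))
      + m ^ 2 * ((L : ℝ) ^ d / (L : ℝ) ^ 2 * ∑ μ, ∑ y, ‖cDv N Rc (fun z => W z μ) y μ‖ ^ 2)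
      + m ^ 2 * (2 * (1 + (d : ℝ) ^ 2) * ((L : ℝ) ^ d * nsqV N W))) := by
    have h := Finset.sum_le_sum fun x (_ : x ∈ (Finset.univ : Finset (Tor (fine L N)))) =>
      Finset.sum_le_sum fun μ (_ : μ ∈ (Finset.univ : Finset (Fin d))) => hU4 x μ
    refine h.trans ?_
    simp only [Finset.mul_sum, mul_add, Finset.sum_add_distrib] at hT1 hT2 hT3 hT4 ⊢
    simp only [← Finset.mul_sum] at hT1 hT2 hT3 hT4 ⊢
    nlinarith [hT1, hT2, hT3, hT4]
  have hd : (0 : ℝ) ≤ d := Nat.cast_nonneg d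
  calc ∑ x, ‖divV (fine L N) R' (fun x' ν' => interpv L N T' Rc (fun z => W z ν') x') x - ((L : ℂ))⁻¹ • interpv L N T' Rc (divV N Rc W) x‖ ^ 2
      ≤ ∑ x, (2 * d * ∑ μ, U x μ ^ 2 + 2 * V x ^ 2) := Finset.sum_le_sum fun x _ => hsq x
    _ = 2 * d * ∑ x, ∑ μ, U x μ ^ 2 + 2 * ∑ x, V x ^ 2 := by rw [Finset.sum_add_distrib, Finset.mul_sum, Finset.mul_sum]
    _ ≤ _ := by nlinarith [mul_le_mul_of_nonneg_left hUsum (by positivity : (0 : ℝ) ≤ 2 * d), hTV]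

end Sum


end Summit.QuantumFields.BalabanUV.T4Continuum.VariationalVectorCentredDiv

end
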